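import Mathlib
import Literature.MathematicalPhysics.QuantumFieldTheory.Balaban1983to89.B11KernelDictionary
import Literature.MathematicalPhysics.QuantumFieldTheory.Balaban1983to89.B11Reparam190
import Literature.MathematicalPhysics.QuantumFieldTheory.Balaban1983to89.B6RandomWalkHom

/-!
# Bałaban, *The variational problem and background fields in renormalization group method for lattice gauge
# theories*, Commun. Math. Phys. **102** (1985) 277–309 — the kernel bounds of G̃ = GP₀* feeding (184)–(190)

T. Bałaban, Commun. Math. Phys. 102 (1985) 277–309, DOI 10.1007/BF01229381 (bib key `Balaban1985Variational`,
"B11"; its reference [5] = Commun. Math. Phys. 99 (1985) 389–434, `Balaban1985BackgroundPropagators`, "B9"; its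
reference [3] = Commun. Math. Phys. 96 (1984) 223–250, `Balaban1984PropagatorsII`, "B6").  Renders read for this
file: `pages/1985-cmp102-variational-background/…-p021/p022/p024/p030-x2.png` (journal pp. 297, 298, 300, 306) and
`pages/1985-cmp99-background-propagators/…-p009/p034-x2.png` (journal pp. 397, 422).

WHAT THIS FILE SUPPLIES.  The kernel-checked chain (182)–(190) of Sect. G (`B11SectG.ineq190_of_189`,
`B11SectG.A0_majorant_of_189`, `B11SectG.A0_strong_of_184`) takes as its FIRST INPUT a majorant of the operator G̃ of
(143)/(180)/(184) between block-normed spaces,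
`hG : HasMaj b3 bN Gt (fun y y' => BG * Real.exp (-(δ₀ * g.dist y y')))`,
located in the paper as follows (verbatim):

* p. 297 [PDF 21]: *"where Δ_a = Δ + DRD* + Q*aQ (the constant a = 1). For the operator Δ_a⁻¹ = G we have proved
  Theorem 3.3 in [5], and especially the bounds (3.42) for the second order operator."*
* (131) p. 298 [PDF 22]: *"Next, let us construct a projection P₀ onto the subspace {A′: QA′ = 0} in the space of
  fields A′ on Ω₀, with the scalar product ⟨·, Δ_a·⟩. It is again very easy to find that the projection is given by
  P₀ = I − GQ*(QGQ*)⁻¹Q. (131)"*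
* p. 300 [PDF 24]: *"By (131) we have the equality GP₀* = G − GQ*(QGQ*)⁻¹ = G̃, hence the above equation can be
  written as A₀ = −G̃J + G̃Δ⁽²⁾(A₀ + H₀B) − G̃((δ/δA′)V)(A₀ + H₀B). (143)"* — the display drops the trailing factor
  QG (cell GAPS G-adv7-5: from (131), GP₀* = G − GQ*(QGQ*)⁻¹QG; this corrected reading is the hypothesis `hGt`
  below, with an abstract operator `Inv` in the place of (QGQ*)⁻¹).
* p. 306 [PDF 30], after (179): *"We may simplify this equation including the operator −Δ⁽²⁾ into the definition
  of G, i.e. defining G = (Δ_a − Δ⁽²⁾)⁻¹. From the estimate (3.137) it follows that Δ⁽²⁾ is a small perturbation of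
  Δ_a, and the new operator G has exactly the same properties as Δ_a⁻¹."* (cell GAPS G-B11-G1; certified in prose by
  cell row C-adv7-11 and in the kernel, for every sup-type left entry of the new G, by
  `B6RandomWalkHom.b11_newG_leftEntry_of_3137` — whose OUTPUT is a two-space majorant of the (3.42) shape below.)
* [5] (3.42) p. 397 [PDF 9]: *"|(G′(U)λ)(x)|, |(∇_U G′(U)λ)(x)|, |(G′(U)∇*_Uλ)(x)|, |(Δ_U G′(U)λ)(x)| ≦ B₀[(Lʲη)²,
  Lʲη, Lʲη, 1]e^{−δ₀d(y,y′)}|λ| for x ∈ Δ(y), y ∈ Λ_j, supp λ ⊂ Δ(y′); (3.42)"* — the CURRENCY of [5]/[3]: sharp sup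
  over the source block, a scale prefactor (Lʲη)ᵖ at the TARGET block (`B6RandomWalkHom.HasMajorantHom`).
* [5] (3.132) p. 422 [PDF 34]: *"The operators (QGQ*)⁻¹, or (QG₁Q*)⁻¹, can be analyzed in the same way as the
  operator (Q′G′²Q′*)⁻¹. We will not repeat these considerations here, let us write only bounds. We have
  |(QGQ*)⁻¹(y, y′)| ≦ O(1)(Lʲη)⁻²(L^{j′}η)^{−d}e^{−δ₁d(y,y′)} for y ∈ Λ_j, y′ ∈ Λ_{j′}, (3.132)"* — the shape of the
  hypothesis `hInv` (an exponentially decaying majorant of the inverse between two B-sizes; for the G₀-based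
  operator this is cell GAPS G-IF-02R / `QGQInverse`).
* (115) p. 294, p. 295, (186) p. 308: the sizes |·|_{(−3)} and max{|·|_{(−1)}, |∇·|_{(−2)}} in which (184)–(190) are
  estimated (`B11KernelDictionary.negSize`, `jetNegSize`): sup over the block WITH the weight (Lʲη)ⁿ.

THE THREE STEPS, each kernel-checked with explicit constants:
(1) CURRENCY BRIDGE (`hasMaj_weighted_of_hom`, `hasMaj_negSize_of_hom`): a two-space majorant K(y, y′) of the
    (3.42)/(2.51) kind IS a `B11SectG.HasMaj` majorant between weighted sharp-block sizes with block-constant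
    weights, with the kernel W_out(y)K(y,y′)/W_in(y′) — exact bookkeeping; for the (3.42) prefactors (Lʲη)ᵖ and the
    sizes |·|_{(−n_in)} → |·|_{(−n_out)} with p + n_out = n_in (= 3 for all four entries of (3.42) read into (186)) the
    kernel is B₀(Lʲη/L^{j′}η)^{n_in}e^{−δ₀d(y,y′)} ≦ B₀L^{n_in}e^{−(δ₀ − n_in ε)d(y,y′)} by the SCALE EXCHANGE of
    `B11KernelDictionary.len_le_exchange` (the level gap (2.60) of Lemma 2.1 [3], log L ≦ εRM): constant L³, rate 3ε.
(2) THE P₀*-SANDWICH (`hasMaj_leftEntry_tildeG`): for any left entry E (identity, ∇, Δ_U, the 1-jet),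
    EG̃ = EG − (EGQ*)·Inv·(QG); with Q, Q* LOCAL of range r (`B11Reparam190.hasMaj_comp_localLeft/Right`: no rate is
    lost on a local factor) and Inv decaying at the rate δ_I, two uses of the row sum (2.61) of Lemma 2.1 [3]
    (`B11SectG.hasMaj_comp_exp`) give EG̃ the majorant
    (B_E + κ₀κ₃κ_Bκ_B′ν_Qν_{Q*}B_I B_E B_G e^{2δ_G r}c²)·e^{−ρd(y,y′)} for every ρ ≧ 0 with ρ + σ ≦ δ_G, ρ + 2σ ≦ δ_I.
(3) THE JET (`hasMaj_jet_of_components`, `jet_tildeG_majorant_of_342`): entries n = 0, 1 of (3.42) for the new G,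
    bridged by (1) and sandwiched by (2) with E = the 1-jet (𝔄 ↦ (𝔄, ∇𝔄)), give LITERALLY the hypothesis `hG` of
    `B11SectG.ineq190_of_189` on the concrete carriers of `B11KernelDictionary` §8 (b3 = |·|_{(−3)}, bN = the jet
    N-size max{|·|_{(−1)}, |∇·|_{(−2)}}), with B_G and the rate explicit; `A0_majorant_of_342` records the plug into `B11SectG.A0_majorant_of_189`.
(4) (`opBound_of_hasMaj_exp`, `theta143_of_majorants`) the same majorants bound the OPERATOR norm of G̃Δ⁽²⁾ in the
    N-size — the located θ of the contraction condition of Proposition 6 for (143)/(180) (p. 300: *"This equation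
    has all the properties of Eq. (111) and Proposition 6 is valid for it also"*; `B11Prop6Scheme.conditions_143`,
    hypothesis 8θ ≦ 1), as θ ≦ κ₃κ_N·B·λ·e^{ρr}·c with λ a column-sum bound of a local majorant of Δ⁽²⁾.

HONEST NOTES. (a) Nothing here proves (3.42), (3.132) or the locality of Q, Q*, Δ⁽²⁾: they are hypotheses of the
printed shape (for the new G = (Δ_a − Δ⁽²⁾)⁻¹ the (3.42)-shape input is the output of
`B6RandomWalkHom.b11_newG_leftEntry_of_3137`, at the rate (1 − α)δ₀). (b) The paper writes ONE letter δ₀ for the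
rate of G̃ in (184)–(190); the honest bookkeeping gives the rate ρ with ρ + σ ≦ δ_G − 3ε, ρ + 2σ ≦ δ_I, where δ_G
is the rate of the (3.42)-shape input, 3ε the scale exchange and σ the row-sum margin — all absorbed in the printed
"O(1)", "δ₀" (cell DIVERGENCE D-B11-25). (c) The B-side sizes `bB`, `bB'` and the majorants of Q, Q*, Inv are kept
abstract: their scale bookkeeping ((Lʲη)⁻², (L^{j′}η)^{−d} of (3.132), the normalisation of Q*) is not displayed in
the paper in a quotable form and is left located (cell GAPS C-B11-G18a).  No parameter window (ε₀(d), κ(d), large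
M) is asserted anywhere in this file.

SIBLINGS REUSED (imported, not restated, not modified): `…B11SectG` (`BlockNorm`, `HasMaj`, `hasMaj_comp_exp`,
`HasMaj.sub/congr/mono/of_rate_le/bound`, `RowSum`, `A0_majorant_of_189`), `…B11KernelDictionary` (`weightedBlocks`,
`loc_le`, `le_loc`, `negSize`, `jetSize`, `jetNegSize`, `jet`, `loc_jet_eq_max`, `LevelGap`, `len_le_exchange`,
`len_pos`), `…B11Reparam190` (`hasMaj_comp_localLeft`, `hasMaj_comp_localRight`), `…B6RandomWalkHom`
(`HasMajorantHom`; `B6RandomWalk.BlockSupp`, `Triangle254`).  Standard axioms only; no `sorry`.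
-/

namespace Literature.MathematicalPhysics.QuantumFieldTheory.Balaban1983to89.B11TildeG190

open Literature.MathematicalPhysics.QuantumFieldTheory.Balaban1983to89
open Finset B6RandomWalk B11SectG B11KernelDictionary B11Reparam190 B6RandomWalkHom

variable {g : B6.Geometry}

/-! ## §1. Currency bridge: [5] (3.42) / [3] (2.51) sharp majorants ⟹ weighted-size majorants -/

section Bridge

variable {X Y : Type} [Fintype X] [Fintype Y]

/-- **Exact re-weighting.**  A two-space majorant K ≧ 0 in the currency of [5] (3.42) / [3] (2.51) (*"|(Tλ)(v)| ≦
K(y, y′)|λ| for v in the block of y, supp λ ⊂ Δ(y′)"*) is a `HasMaj` majorant between the weighted sharp-block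
sizes with BLOCK-CONSTANT weights W_in > 0 (source) and W_out ≧ 0 (target), with the kernel
W_out(y)·K(y, y′)/W_in(y′): sup_{Δ(y′)} W_in|λ| = W_in(y′)·|λ| and sup_{block of y} W_out|Tλ| = W_out(y)·sup|Tλ|.
[cite: Balaban1985BackgroundPropagators, (3.41)–(3.42) p.397; Balaban1985Variational, (115) p.294] -/
theorem hasMaj_weighted_of_hom (blkX : X → g.Site) (blkY : Y → g.Site) {T : (X → ℝ) →ₗ[ℝ] (Y → ℝ)}
    {K : g.Site → g.Site → ℝ} (hK : ∀ a b, 0 ≤ K a b) (Win Wout : g.Site → ℝ) (hWin : ∀ y, 0 < Win y)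
    (hWout : ∀ y, 0 ≤ Wout y) (hWin' : ∀ x : X, 0 ≤ Win (blkX x)) (hWout' : ∀ v : Y, 0 ≤ Wout (blkY v))
    (h : HasMajorantHom blkX blkY T K) :
    HasMaj (weightedBlocks g blkX (fun x => Win (blkX x)) hWin')
      (weightedBlocks g blkY (fun v => Wout (blkY v)) hWout') T (fun y y' => Wout y * K y y' / Win y') := by
  intro y' μ hμ y
  have hμ' : ∀ x, blkX x ≠ y' → μ x = 0 := hμ
  have hℓ0 : 0 ≤ (weightedBlocks g blkX (fun x => Win (blkX x)) hWin').loc y' μ :=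
    (weightedBlocks g blkX (fun x => Win (blkX x)) hWin').loc_nonneg y' μ
  have hsupp : BlockSupp blkX μ y' ((weightedBlocks g blkX (fun x => Win (blkX x)) hWin').loc y' μ / Win y') := by
    refine ⟨div_nonneg hℓ0 (hWin y').le, fun x hx => ?_, fun x hx => hμ' x hx⟩
    rw [le_div_iff₀ (hWin y'), mul_comm]
    have hx' : Win (blkX x) * |μ x| ≤ (weightedBlocks g blkX (fun x => Win (blkX x)) hWin').loc y' μ :=
      le_loc (blk := blkX) (wt := fun x => Win (blkX x)) (hwt := hWin') μ hx
    rwa [hx] at hx'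
  refine loc_le (mul_nonneg (div_nonneg (mul_nonneg (hWout y) (hK y y')) (hWin y').le) hℓ0) fun v hv => ?_
  have hT := h y' μ _ hsupp v
  rw [hv] at hT
  calc Wout (blkY v) * |T μ v| = Wout y * |T μ v| := by rw [hv]
    _ ≤ Wout y * (K y y' * ((weightedBlocks g blkX (fun x => Win (blkX x)) hWin').loc y' μ / Win y')) :=
        mul_le_mul_of_nonneg_left hT (hWout y)
    _ = _ := by ring

/-- **Scale exchange for powers**: (Lʲη)ᵗ ≦ Lᵗ·e^{tεd(y,y′)}·(L^{j′}η)ᵗ under the level gap of (2.60) [3], L ≧ 1,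
log L ≦ εRM (`B11KernelDictionary.len_le_exchange` raised to the power t).
[cite: Balaban1984PropagatorsII, Lemma 2.1 (2.60) p.234; Balaban1985BackgroundPropagators, (3.133) p.422] -/
theorem len_pow_le_exchange (hL : 1 ≤ g.L) (hη : 0 ≤ g.eta) (hd : ∀ a b : g.Site, 0 ≤ g.dist a b)
    (hgap : LevelGap g) {ε : ℝ} (hε : 0 ≤ ε) (hεL : Real.log g.L ≤ ε * (g.R * g.M)) (t : ℕ) (y y' : g.Site) :
    g.len y ^ t ≤ g.L ^ t * Real.exp ((t : ℝ) * (ε * g.dist y y')) * g.len y' ^ t := by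
  have h := len_le_exchange hL hη hd hgap hε hεL y y'
  have h0 : 0 ≤ g.len y := mul_nonneg (pow_nonneg (zero_le_one.trans hL) _) hη
  calc g.len y ^ t ≤ (g.L * Real.exp (ε * g.dist y y') * g.len y') ^ t := pow_le_pow_left₀ h0 h t
    _ = g.L ^ t * Real.exp ((t : ℝ) * (ε * g.dist y y')) * g.len y' ^ t := by
        rw [mul_pow, mul_pow, ← Real.exp_nat_mul]

/-- **(3.42)-currency ⟹ (115)/(186)-currency.**  A two-space majorant of the (3.42) shape A·(Lʲη)ᵖ·e^{−δd(y,y′)}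
(prefactor at the target block y ∈ Λ_j) for an operator T read from the size |·|_{(−n_in)} into |·|_{(−n_out)} with
p + n_out = n_in is the `HasMaj` majorant A·L^{n_in}·e^{−(δ − n_in ε)d(y,y′)}: the weights produce
(Lʲη)^{p+n_out}(L^{j′}η)^{−n_in} = (Lʲη/L^{j′}η)^{n_in}, exchanged by `len_pow_le_exchange`.  The four entries of (3.42)
(p = 2, 1, 1, 0) read into |·|_{(−1)}, |∇·|_{(−2)}, ·, |Δ·|_{(−3)} from |·|_{(−3)} all have n_in = 3: constant L³, rate 3ε.
[cite: Balaban1985BackgroundPropagators, (3.42) p.397; Balaban1985Variational, (115) p.294 + (186) p.308] -/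
theorem hasMaj_negSize_of_hom (hL : 1 ≤ g.L) (hη : 0 < g.eta) (hd : ∀ a b : g.Site, 0 ≤ g.dist a b)
    (hgap : LevelGap g) {ε : ℝ} (hε : 0 ≤ ε) (hεL : Real.log g.L ≤ ε * (g.R * g.M))
    (blkX : X → g.Site) (blkY : Y → g.Site) {T : (X → ℝ) →ₗ[ℝ] (Y → ℝ)} {A δ : ℝ} (hA : 0 ≤ A)
    {p nout nin : ℕ} (hp : p + nout = nin)
    (h : HasMajorantHom blkX blkY T (fun a b => A * g.len a ^ p * Real.exp (-(δ * g.dist a b)))) :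
    HasMaj (negSize g blkX nin (zero_le_one.trans hL) hη.le) (negSize g blkY nout (zero_le_one.trans hL) hη.le) T
      (fun y y' => A * g.L ^ nin * Real.exp (-((δ - nin * ε) * g.dist y y'))) := by
  have hL0 : 0 < g.L := lt_of_lt_of_le one_pos hL
  have hlen : ∀ y, 0 < g.len y := len_pos hL0 hη
  have hK : ∀ a b, 0 ≤ A * g.len a ^ p * Real.exp (-(δ * g.dist a b)) := fun a b =>
    mul_nonneg (mul_nonneg hA (pow_nonneg (hlen a).le p)) (Real.exp_nonneg _)
  have h1 := hasMaj_weighted_of_hom (g := g) blkX blkY hK (fun y => g.len y ^ nin) (fun y => g.len y ^ nout)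
    (fun y => pow_pos (hlen y) nin) (fun y => pow_nonneg (hlen y).le nout)
    (fun x => pow_nonneg (hlen (blkX x)).le nin) (fun v => pow_nonneg (hlen (blkY v)).le nout) h
  refine h1.mono fun y y' => ?_
  have hex := len_pow_le_exchange hL hη.le hd hgap hε hεL nin y y'
  rw [div_le_iff₀ (pow_pos (hlen y') nin)]
  calc g.len y ^ nout * (A * g.len y ^ p * Real.exp (-(δ * g.dist y y')))
      = A * Real.exp (-(δ * g.dist y y')) * g.len y ^ nin := by rw [← hp, pow_add]; ring
    _ ≤ A * Real.exp (-(δ * g.dist y y')) * (g.L ^ nin * Real.exp ((nin : ℝ) * (ε * g.dist y y')) * g.len y' ^ nin) :=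
        mul_le_mul_of_nonneg_left hex (mul_nonneg hA (Real.exp_nonneg _))
    _ = A * g.L ^ nin * Real.exp (-((δ - nin * ε) * g.dist y y')) * g.len y' ^ nin := by
        rw [show -((δ - (nin : ℝ) * ε) * g.dist y y') = -(δ * g.dist y y') + (nin : ℝ) * (ε * g.dist y y') by ring,
          Real.exp_add]
        ring

end Bridge

/-! ## §2. The 1-jet as a left entry: max{|·|_{(−1)}, |∇·|_{(−2)}} from the two component majorants -/

section Jet

variable {F : Type} [AddCommGroup F] [Module ℝ F] {X₀ X₁ : Type} [Fintype X₀] [Fintype X₁]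

/-- **Component majorants ⟹ jet majorant** for an arbitrary operator T (not only kernel operators, cf.
`B11KernelDictionary.hasMaj_jet_iff`): if T has the majorant K into the weighted size on X₀ and ∇T has the SAME
majorant K into the weighted size on X₁, then the 1-jet (T, ∇T) has the majorant K into the jet size — the size IS
the maximum of the two (`loc_jet_eq_max`), *"max{|𝔄|_{(−1)}, |∇𝔄|_{(−2)}}"* (p. 295).
[cite: Balaban1985Variational, (115) p.294 + p.295 + (186) p.308] -/
theorem hasMaj_jet_of_components (b : BlockNorm g F) (blk₀ : X₀ → g.Site) (blk₁ : X₁ → g.Site) (wt₀ : X₀ → ℝ)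
    (wt₁ : X₁ → ℝ) (h₀ : ∀ x, 0 ≤ wt₀ x) (h₁ : ∀ x, 0 ≤ wt₁ x) (D : (X₀ → ℝ) →ₗ[ℝ] (X₁ → ℝ))
    {T : F →ₗ[ℝ] (X₀ → ℝ)} {K : g.Site → g.Site → ℝ}
    (hT₀ : HasMaj b (weightedBlocks g blk₀ wt₀ h₀) T K)
    (hT₁ : HasMaj b (weightedBlocks g blk₁ wt₁ h₁) (D ∘ₗ T) K) :
    HasMaj b (jetSize g blk₀ blk₁ wt₀ wt₁ h₀ h₁) (jet D ∘ₗ T) K := by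
  intro y' μ hμ y
  rw [LinearMap.comp_apply, loc_jet_eq_max]
  have e0 : (jet D (T μ)) ∘ Sum.inl = T μ := rfl
  have e1 : (jet D (T μ)) ∘ Sum.inr = D (T μ) := rfl
  rw [e0, e1]
  exact max_le (hT₀ y' μ hμ y) (hT₁ y' μ hμ y)

end Jet

/-! ## §3. The P₀*-sandwich: G̃ = GP₀* = G − GQ*(QGQ*)⁻¹QG inherits the majorants of G -/

section Sandwich

variable {F3 FA FB FE : Type} [AddCommGroup F3] [Module ℝ F3] [AddCommGroup FA] [Module ℝ FA]
  [AddCommGroup FB] [Module ℝ FB] [AddCommGroup FE] [Module ℝ FE]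

/-- **Every left entry of G̃ = GP₀* inherits the majorant of the same entry of G.**  Setting: G : F3 → FA (sizes
b3 → b0 for the entry feeding Q, b3 → bE for the left entry E·G under study), Q : FA → FB LOCAL of range r (majorant
K_Q ≧ 0 vanishing unless d ≦ r, row sums ≦ ν_Q), Q* : FB → F3 LOCAL of range r (column sums ≦ ν_{Q*}), Inv : FB → FB
(the operator (QGQ*)⁻¹ of (131); majorant B_I e^{−δ_I d} from the size bB into bB′ — the shape of [5] (3.132)), and
G̃ = G − GQ*·Inv·QG ((131) p. 298 and the display of p. 300, corrected: cell GAPS G-adv7-5).  Then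
EG̃ = EG − (EGQ*)·Inv·(QG) has the majorant (B_E + κ₀κ₃κ_Bκ_{B′}ν_Qν_{Q*}B_I B_E B_G e^{δ_G r}e^{δ_G r}c·c)·e^{−ρd(y,y′)}
for every ρ ≧ 0, σ ≧ 0 with ρ + σ ≦ δ_G and ρ + 2σ ≦ δ_I, σ being the rate at which the row sum (2.61) of Lemma 2.1
[3] is used (twice).  With E = I this is G̃ itself; with E = ∇, Δ_U, the 1-jet, the other entries of (3.42)/(186).
[cite: Balaban1985Variational, (131) p.298 + p.300 + p.306; Balaban1985BackgroundPropagators, (3.42) p.397 + (3.132) p.422; Balaban1984PropagatorsII, Lemma 2.1 (2.61) + (2.52)–(2.56) pp.232–234] -/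
theorem hasMaj_leftEntry_tildeG {b3 : BlockNorm g F3} {b0 : BlockNorm g FA} {bB bB' : BlockNorm g FB}
    {bE : BlockNorm g FE} {G Gt : F3 →ₗ[ℝ] FA} {Q : FA →ₗ[ℝ] FB} {Qs : FB →ₗ[ℝ] F3} {Inv : FB →ₗ[ℝ] FB}
    (E : FA →ₗ[ℝ] FE) {KQ KQs : g.Site → g.Site → ℝ} {BG BE BI δG δI ρ σ c r νQ νs : ℝ}
    (htri : Triangle254 g) (hd : ∀ a b : g.Site, 0 ≤ g.dist a b) (hrow : RowSum g σ c)
    (hc : 0 ≤ c) (hBG : 0 ≤ BG) (hBE : 0 ≤ BE) (hBI : 0 ≤ BI) (hνQ : 0 ≤ νQ) (hνs : 0 ≤ νs) (hρ : 0 ≤ ρ)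
    (hσ : 0 ≤ σ) (hρG : ρ + σ ≤ δG) (hρI : ρ + 2 * σ ≤ δI)
    (hGt : Gt = G - (G ∘ₗ Qs) ∘ₗ Inv ∘ₗ (Q ∘ₗ G))
    (hG0 : HasMaj b3 b0 G (fun a b => BG * Real.exp (-(δG * g.dist a b))))
    (hGE : HasMaj b3 bE (E ∘ₗ G) (fun a b => BE * Real.exp (-(δG * g.dist a b))))
    (hKQ : ∀ a b, 0 ≤ KQ a b) (hQloc : ∀ a b, KQ a b ≠ 0 → g.dist a b ≤ r)
    (hQrow : ∀ a, ∑ b : g.Site, KQ a b ≤ νQ) (hQ : HasMaj b0 bB Q KQ)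
    (hKQs : ∀ a b, 0 ≤ KQs a b) (hQsloc : ∀ a b, KQs a b ≠ 0 → g.dist a b ≤ r)
    (hQscol : ∀ b, ∑ a : g.Site, KQs a b ≤ νs) (hQs : HasMaj bB' b3 Qs KQs)
    (hInv : HasMaj bB bB' Inv (fun a b => BI * Real.exp (-(δI * g.dist a b)))) :
    HasMaj b3 bE (E ∘ₗ Gt) (fun a b =>
      (BE + b0.κ * b3.κ * bB.κ * bB'.κ * νQ * νs * BI * BE * BG * Real.exp (δG * r) * Real.exp (δG * r) * c * c) *
        Real.exp (-(ρ * g.dist a b))) := by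
  have hδG : 0 ≤ δG := by linarith
  have hρσ : 0 ≤ ρ + σ := by linarith
  have hCpos : 0 ≤ b0.κ * BG * νQ * Real.exp (δG * r) :=
    mul_nonneg (mul_nonneg (mul_nonneg b0.κ_nonneg hBG) hνQ) (Real.exp_nonneg _)
  have hApos : 0 ≤ b3.κ * BE * νs * Real.exp (δG * r) :=
    mul_nonneg (mul_nonneg (mul_nonneg b3.κ_nonneg hBE) hνs) (Real.exp_nonneg _)
  have hICpos : 0 ≤ bB.κ * BI * (b0.κ * BG * νQ * Real.exp (δG * r)) * c :=
    mul_nonneg (mul_nonneg (mul_nonneg bB.κ_nonneg hBI) hCpos) hc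
  -- C := QG : b3 → bB, the local factor Q costs no rate
  have hC : HasMaj b3 bB (Q ∘ₗ G)
      (fun a b => b0.κ * BG * νQ * Real.exp (δG * r) * Real.exp (-(δG * g.dist a b))) :=
    hasMaj_comp_localLeft htri hBG hδG hKQ hQloc hQrow hQ hG0
  -- Inv·C : b3 → bB′ at the rate ρ + σ (first row sum)
  have hIC : HasMaj b3 bB' (Inv ∘ₗ (Q ∘ₗ G))
      (fun a b => bB.κ * BI * (b0.κ * BG * νQ * Real.exp (δG * r)) * c *
        Real.exp (-((ρ + σ) * g.dist a b))) :=
    hasMaj_comp_exp htri hd hrow hBI hCpos hρσ hρG (by linarith) hInv hC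
  -- A := EGQ* : bB′ → bE, the local factor Q* costs no rate
  have hA : HasMaj bB' bE ((E ∘ₗ G) ∘ₗ Qs)
      (fun a b => b3.κ * BE * νs * Real.exp (δG * r) * Real.exp (-(δG * g.dist a b))) :=
    hasMaj_comp_localRight htri hBE hδG hKQs hQsloc hQscol hGE hQs
  -- A·(Inv·C) : b3 → bE at the rate ρ (second row sum)
  have hAIC : HasMaj b3 bE (((E ∘ₗ G) ∘ₗ Qs) ∘ₗ (Inv ∘ₗ (Q ∘ₗ G)))
      (fun a b => bB'.κ * (b3.κ * BE * νs * Real.exp (δG * r)) *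
        (bB.κ * BI * (b0.κ * BG * νQ * Real.exp (δG * r)) * c) * c * Real.exp (-(ρ * g.dist a b))) :=
    hasMaj_comp_exp htri hd hrow hApos hICpos hρ (by linarith) hρG hA hIC
  -- EG at the rate ρ
  have hEGρ : HasMaj b3 bE (E ∘ₗ G) (fun a b => BE * Real.exp (-(ρ * g.dist a b))) :=
    hGE.of_rate_le hd hBE (by linarith)
  have hop : ∀ μ, ((E ∘ₗ G) - ((E ∘ₗ G) ∘ₗ Qs) ∘ₗ (Inv ∘ₗ (Q ∘ₗ G))) μ = (E ∘ₗ Gt) μ := by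
    intro μ
    rw [hGt]
    simp only [LinearMap.sub_apply, LinearMap.comp_apply, map_sub]
  refine ((hEGρ.sub hAIC).congr hop).mono fun a b => le_of_eq ?_
  ring


/-! ## §4. Operator bounds from majorants: the located θ of (143)/(180) -/

/-- **Sup bound from an exponentially decaying majorant** (the passage *"… or |Δ_{U₀}H₀B|_{(−3)} ≦ B₀|B|"* of
(130), for arbitrary block-normed spaces; cf. `B11KernelDictionary.opBound_of_hasMaj` for the B-size source): if T
has the majorant C·e^{−ρd} from b₁ into b₂ and the row sum (2.61) of Lemma 2.1 [3] holds at the rate ρ with the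
constant c, then sup_y loc_y(Tf) ≦ κ₁·C·c·sup_{y′} loc_{y′}(f).
[cite: Balaban1985Variational, (130) p.298; Balaban1984PropagatorsII, (2.52)–(2.53) p.232 + (2.61) p.234] -/
theorem opBound_of_hasMaj_exp {F₁ F₂ : Type} [AddCommGroup F₁] [Module ℝ F₁] [AddCommGroup F₂] [Module ℝ F₂]
    (b₁ : BlockNorm g F₁) (b₂ : BlockNorm g F₂) {T : F₁ →ₗ[ℝ] F₂} {C ρ c M : ℝ} (hC : 0 ≤ C)
    (hrow : RowSum g ρ c) (h : HasMaj b₁ b₂ T (fun a b => C * Real.exp (-(ρ * g.dist a b)))) (f : F₁)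
    (hM0 : 0 ≤ M) (hM : ∀ y', b₁.loc y' f ≤ M) (y : g.Site) :
    b₂.loc y (T f) ≤ b₁.κ * C * c * M := by
  have hK : ∀ a b, 0 ≤ C * Real.exp (-(ρ * g.dist a b)) := fun a b => mul_nonneg hC (Real.exp_nonneg _)
  have hb := h.bound hK f y
  have hterm : ∀ y', C * Real.exp (-(ρ * g.dist y y')) * (b₁.κ * b₁.loc y' f) ≤
      C * Real.exp (-(ρ * g.dist y y')) * (b₁.κ * M) := fun y' =>
    mul_le_mul_of_nonneg_left (mul_le_mul_of_nonneg_left (hM y') b₁.κ_nonneg) (hK y y')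
  calc b₂.loc y (T f) ≤ _ := hb
    _ ≤ ∑ y' : g.Site, C * Real.exp (-(ρ * g.dist y y')) * (b₁.κ * M) :=
        Finset.sum_le_sum fun y' _ => hterm y'
    _ = b₁.κ * C * M * ∑ y' : g.Site, Real.exp (-(ρ * g.dist y y')) := by
        rw [Finset.mul_sum]
        exact Finset.sum_congr rfl fun y' _ => by ring
    _ ≤ b₁.κ * C * M * c :=
        mul_le_mul_of_nonneg_left (hrow y) (mul_nonneg (mul_nonneg b₁.κ_nonneg hC) hM0)
    _ = b₁.κ * C * c * M := by ring

/-- **The located θ of the contraction condition for (143)/(180)** (p. 300: *"This equation has all the properties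
of Eq. (111) and Proposition 6 is valid for it also"*; the scheme `B11Prop6Scheme.conditions_143` takes the
operator bound θ of G̃Δ⁽²⁾ in the N-size with 8θ ≦ 1 as a hypothesis): if G̃ has the majorant B·e^{−ρd} from
|·|_{(−3)} (b3) into the N-size (bN) and Δ⁽²⁾ has a LOCAL majorant K_D ≧ 0 of range r with column sums ≦ λ from bN
into b3 (Δ⁽²⁾ is a second-order difference operator with the small coefficients R(U₀(∂p)) − 1 of (135), bounded
through (14) and [5] (3.137)), then ‖G̃Δ⁽²⁾f‖_N ≦ θ·‖f‖_N with θ = κ_N·κ₃·B·λ·e^{ρr}·c.  The smallness 8θ ≦ 1 is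
then a smallness of λ, i.e. of ε₀ — located, not derived.
[cite: Balaban1985Variational, (135) p.298 + (143) p.300 + (180) p.306; Balaban1985BackgroundPropagators, (3.137) p.423] -/
theorem theta143_of_majorants {bN : BlockNorm g FA} {b3 : BlockNorm g F3} {Gt : F3 →ₗ[ℝ] FA}
    {D2 : FA →ₗ[ℝ] F3} {KD : g.Site → g.Site → ℝ} {B ρ r lam c M : ℝ} (htri : Triangle254 g) (hB : 0 ≤ B)
    (hρ : 0 ≤ ρ) (hlam : 0 ≤ lam) (hrow : RowSum g ρ c)
    (hGt : HasMaj b3 bN Gt (fun a b => B * Real.exp (-(ρ * g.dist a b))))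
    (hKD : ∀ a b, 0 ≤ KD a b) (hDloc : ∀ a b, KD a b ≠ 0 → g.dist a b ≤ r)
    (hDcol : ∀ b, ∑ a : g.Site, KD a b ≤ lam) (hD2 : HasMaj bN b3 D2 KD)
    (f : FA) (hM0 : 0 ≤ M) (hM : ∀ y', bN.loc y' f ≤ M) (y : g.Site) :
    bN.loc y ((Gt ∘ₗ D2) f) ≤ bN.κ * (b3.κ * B * lam * Real.exp (ρ * r)) * c * M := by
  have hcomp : HasMaj bN bN (Gt ∘ₗ D2)
      (fun a b => b3.κ * B * lam * Real.exp (ρ * r) * Real.exp (-(ρ * g.dist a b))) :=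
    hasMaj_comp_localRight htri hB hρ hKD hDloc hDcol hGt hD2
  exact opBound_of_hasMaj_exp bN bN
    (mul_nonneg (mul_nonneg (mul_nonneg b3.κ_nonneg hB) hlam) (Real.exp_nonneg _)) hrow hcomp f hM0 hM y

end Sandwich

/-! ## §5. End-to-end on the concrete carriers: [5] (3.42) for the new G ⟹ the input `hG` of (184)–(190) -/

section Concrete

variable {X X₁ : Type} [Fintype X] [Fintype X₁] {FB : Type} [AddCommGroup FB] [Module ℝ FB]

/-- **[5] (3.42), entries n = 0, 1, for the new G ⟹ the hypothesis `hG` of `B11SectG.ineq190_of_189` /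
`A0_majorant_of_189`** on the concrete carriers of `B11KernelDictionary` §8: X = the points of 𝔄 (blocks `blk`),
X₁ = the points of ∇𝔄 (blocks `blk₁`), ∇ = `D`, b3 = |·|_{(−3)} (`negSize g blk 3`), bN = max{|·|_{(−1)}, |∇·|_{(−2)}}
(`jetNegSize g blk blk₁ 1 2`), G̃ = G − GQ*·Inv·QG.  INPUTS of the printed shape: `h342_0`, `h342_1` = the first two
entries of (3.42) for G (for G = (Δ_a − Δ⁽²⁾)⁻¹: the output of `B6RandomWalkHom.b11_newG_leftEntry_of_3137`, rate
δ_G = (1 − α)δ₀); Q, Q* local of range r with row/column sums ν_Q, ν_{Q*} between the stated sizes; Inv = (QGQ*)⁻¹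
with a majorant of the (3.132) shape between two B-sizes bB, bB′; the geometry of Lemma 2.1 [3] ((2.54), (2.60) as
the level gap, (2.61) at the margin σ), L ≧ 1, η > 0, log L ≦ εRM.  OUTPUT: the 1-jet of G̃ has the majorant
B_G̃·e^{−ρd(y,y′)}, B_G̃ = B₀L³ + κ_Bκ_{B′}ν_Qν_{Q*}B_I(B₀L³)²e^{2(δ_G−3ε)r}c², for every ρ ≧ 0 with ρ + σ ≦ δ_G − 3ε and ρ + 2σ ≦ δ_I — the single printed letter
δ₀ of (184)–(190) READ AS this ρ (cell DIVERGENCE D-B11-25).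
[cite: Balaban1985Variational, p.297 + (131) p.298 + p.300 + p.306 + (184)–(190) pp.307–308; Balaban1985BackgroundPropagators, (3.42) p.397 + (3.132) p.422; Balaban1984PropagatorsII, Lemma 2.1 pp.233–234] -/
theorem jet_tildeG_majorant_of_342 (hL : 1 ≤ g.L) (hη : 0 < g.eta) (hd : ∀ a b : g.Site, 0 ≤ g.dist a b)
    (hgap : LevelGap g) {ε : ℝ} (hε : 0 ≤ ε) (hεL : Real.log g.L ≤ ε * (g.R * g.M))
    (htri : Triangle254 g) {σ c : ℝ} (hrow : RowSum g σ c) (hc : 0 ≤ c) (hσ : 0 ≤ σ)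
    (blk : X → g.Site) (blk₁ : X₁ → g.Site) (D : (X → ℝ) →ₗ[ℝ] (X₁ → ℝ))
    {bB bB' : BlockNorm g FB} {G Gt : (X → ℝ) →ₗ[ℝ] (X → ℝ)} {Q : (X → ℝ) →ₗ[ℝ] FB} {Qs : FB →ₗ[ℝ] (X → ℝ)}
    {Inv : FB →ₗ[ℝ] FB} (hGt : Gt = G - (G ∘ₗ Qs) ∘ₗ Inv ∘ₗ (Q ∘ₗ G))
    {B₀ δG BI δI ρ r νQ νs : ℝ} (hB₀ : 0 ≤ B₀) (hBI : 0 ≤ BI) (hνQ : 0 ≤ νQ) (hνs : 0 ≤ νs) (hρ : 0 ≤ ρ)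
    (hρG : ρ + σ ≤ δG - 3 * ε) (hρI : ρ + 2 * σ ≤ δI)
    (h342_0 : HasMajorantHom blk blk G (fun a b => B₀ * g.len a ^ 2 * Real.exp (-(δG * g.dist a b))))
    (h342_1 : HasMajorantHom blk blk₁ (D ∘ₗ G) (fun a b => B₀ * g.len a ^ 1 * Real.exp (-(δG * g.dist a b))))
    {KQ KQs : g.Site → g.Site → ℝ}
    (hKQ : ∀ a b, 0 ≤ KQ a b) (hQloc : ∀ a b, KQ a b ≠ 0 → g.dist a b ≤ r)
    (hQrow : ∀ a, ∑ b : g.Site, KQ a b ≤ νQ)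
    (hQ : HasMaj (negSize g blk 1 (zero_le_one.trans hL) hη.le) bB Q KQ)
    (hKQs : ∀ a b, 0 ≤ KQs a b) (hQsloc : ∀ a b, KQs a b ≠ 0 → g.dist a b ≤ r)
    (hQscol : ∀ b, ∑ a : g.Site, KQs a b ≤ νs)
    (hQs : HasMaj bB' (negSize g blk 3 (zero_le_one.trans hL) hη.le) Qs KQs)
    (hInv : HasMaj bB bB' Inv (fun a b => BI * Real.exp (-(δI * g.dist a b)))) :
    HasMaj (negSize g blk 3 (zero_le_one.trans hL) hη.le) (jetNegSize g blk blk₁ 1 2 (zero_le_one.trans hL) hη.le)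
      (jet D ∘ₗ Gt)
      (fun a b => (B₀ * g.L ^ 3 + bB.κ * bB'.κ * νQ * νs * BI * (B₀ * g.L ^ 3) * (B₀ * g.L ^ 3) *
          Real.exp ((δG - 3 * ε) * r) * Real.exp ((δG - 3 * ε) * r) * c * c) * Real.exp (-(ρ * g.dist a b))) := by
  have hL0 : 0 < g.L := lt_of_lt_of_le one_pos hL
  have hBG : 0 ≤ B₀ * g.L ^ 3 := mul_nonneg hB₀ (pow_nonneg hL0.le 3)
  -- (1) the bridge, entries 0 and 1 of (3.42)
  have hG0 := hasMaj_negSize_of_hom hL hη hd hgap hε hεL blk blk hB₀ (p := 2) (nout := 1) (nin := 3) rfl h342_0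
  have hG1 := hasMaj_negSize_of_hom hL hη hd hgap hε hεL blk blk₁ hB₀ (p := 1) (nout := 2) (nin := 3) rfl h342_1
  simp only [Nat.cast_ofNat] at hG0 hG1
  -- (2) the 1-jet of G
  have hGJ : HasMaj (negSize g blk 3 (zero_le_one.trans hL) hη.le)
      (jetNegSize g blk blk₁ 1 2 (zero_le_one.trans hL) hη.le) (jet D ∘ₗ G)
      (fun a b => B₀ * g.L ^ 3 * Real.exp (-((δG - 3 * ε) * g.dist a b))) :=
    hasMaj_jet_of_components _ blk blk₁ _ _ _ _ D hG0 hG1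
  -- (3) the sandwich with the left entry E = the 1-jet
  have hS := hasMaj_leftEntry_tildeG (jet D) htri hd hrow hc hBG hBG hBI hνQ hνs hρ hσ hρG hρI hGt hG0 hGJ
    hKQ hQloc hQrow hQ hKQs hQsloc hQscol hQs hInv
  have hk1 : (negSize g blk 1 (zero_le_one.trans hL) hη.le).κ = 1 := rfl
  have hk3 : (negSize g blk 3 (zero_le_one.trans hL) hη.le).κ = 1 := rfl
  refine hS.mono fun a b => le_of_eq ?_
  rw [hk1, hk3]
  ring

/-- **The plug, kernel-checked: (3.42) for the new G in, (188)–(189) ⟹ the decay of 𝔄₀ out.**  With the 1-jet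
majorant of G̃ supplied by `jet_tildeG_majorant_of_342` as the hypothesis `hG` of `B11SectG.A0_majorant_of_189`
(the printed δ₀ of (184)–(190) read as the honest rate ρ, B_G as the constant B_G̃ of that theorem), the remaining located inputs of the
chain — (189) (cell GAPS G-B11-G2), Δ⁽²⁾H₀ of (130), H₀ of (129)/(3.133) [5], (184), (188), the row sum of Lemma
2.1 [3] at the summable factor e^{−⅛ρd}, the located smallness q < 1 of (187) — yield the majorant
constA0·e^{−⅛ρd(y,y′)} of 𝔄₀ = (δ/δB)𝒜₀ from the B-size into max{|·|_{(−1)}, |∇·|_{(−2)}} (κ₃ = κ_N = 1 on the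
sharp-block carriers).  Nothing new is proved here: the theorem records that the types fit.
[cite: Balaban1985Variational, (184)–(190) pp.307–308; Balaban1985BackgroundPropagators, (3.42) p.397] -/
theorem A0_majorant_of_342 (hL : 1 ≤ g.L) (hη : 0 < g.eta) (hd : ∀ a b : g.Site, 0 ≤ g.dist a b)
    (hgap : LevelGap g) {ε : ℝ} (hε : 0 ≤ ε) (hεL : Real.log g.L ≤ ε * (g.R * g.M))
    (htri : Triangle254 g) {σ c : ℝ} (hrow : RowSum g σ c) (hc : 0 ≤ c) (hσ : 0 ≤ σ)
    (blk : X → g.Site) (blk₁ : X₁ → g.Site) (D : (X → ℝ) →ₗ[ℝ] (X₁ → ℝ))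
    {bB bB' : BlockNorm g FB} {G Gt : (X → ℝ) →ₗ[ℝ] (X → ℝ)} {Q : (X → ℝ) →ₗ[ℝ] FB} {Qs : FB →ₗ[ℝ] (X → ℝ)}
    {Inv : FB →ₗ[ℝ] FB} (hGt : Gt = G - (G ∘ₗ Qs) ∘ₗ Inv ∘ₗ (Q ∘ₗ G))
    {B₀ δG BI δI ρ r νQ νs : ℝ} (hB₀ : 0 ≤ B₀) (hBI : 0 ≤ BI) (hνQ : 0 ≤ νQ) (hνs : 0 ≤ νs) (hρ : 0 ≤ ρ)
    (hρG : ρ + σ ≤ δG - 3 * ε) (hρI : ρ + 2 * σ ≤ δI)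
    (h342_0 : HasMajorantHom blk blk G (fun a b => B₀ * g.len a ^ 2 * Real.exp (-(δG * g.dist a b))))
    (h342_1 : HasMajorantHom blk blk₁ (D ∘ₗ G) (fun a b => B₀ * g.len a ^ 1 * Real.exp (-(δG * g.dist a b))))
    {KQ KQs : g.Site → g.Site → ℝ}
    (hKQ : ∀ a b, 0 ≤ KQ a b) (hQloc : ∀ a b, KQ a b ≠ 0 → g.dist a b ≤ r)
    (hQrow : ∀ a, ∑ b : g.Site, KQ a b ≤ νQ)
    (hQ : HasMaj (negSize g blk 1 (zero_le_one.trans hL) hη.le) bB Q KQ)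
    (hKQs : ∀ a b, 0 ≤ KQs a b) (hQsloc : ∀ a b, KQs a b ≠ 0 → g.dist a b ≤ r)
    (hQscol : ∀ b, ∑ a : g.Site, KQs a b ≤ νs)
    (hQs : HasMaj bB' (negSize g blk 3 (zero_le_one.trans hL) hη.le) Qs KQs)
    (hInv : HasMaj bB bB' Inv (fun a b => BI * Real.exp (-(δI * g.dist a b))))
    {FB₂ : Type} [AddCommGroup FB₂] [Module ℝ FB₂] {bB₂ : BlockNorm g FB₂}
    {W : (X ⊕ X₁ → ℝ) →ₗ[ℝ] (X → ℝ)} {D2H0 : FB₂ →ₗ[ℝ] (X → ℝ)} {H0 A0 : FB₂ →ₗ[ℝ] (X ⊕ X₁ → ℝ)}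
    {θW cΔ A₀ M₀ c₈ : ℝ} (hrow₈ : RowSum g (ρ / 8) c₈) (hc₈ : 0 ≤ c₈) (hθW : 0 ≤ θW) (hcΔ : 0 ≤ cΔ)
    (hA₀ : 0 ≤ A₀) (hM₀ : 0 ≤ M₀)
    (h189 : Ineq189 (jetNegSize g blk blk₁ 1 2 (zero_le_one.trans hL) hη.le)
      (negSize g blk 3 (zero_le_one.trans hL) hη.le) W θW ρ)
    (hD2H0 : HasMaj bB₂ (negSize g blk 3 (zero_le_one.trans hL) hη.le) D2H0
      (fun y y' => cΔ * Real.exp (-(ρ * g.dist y y'))))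
    (hH0 : HasMaj bB₂ (jetNegSize g blk blk₁ 1 2 (zero_le_one.trans hL) hη.le) H0
      (fun y y' => A₀ * Real.exp (-(ρ * g.dist y y'))))
    (h184 : Eq184 A0 H0 (jet D ∘ₗ Gt) W D2H0)
    (h188 : Bound188 bB₂ (jetNegSize g blk blk₁ 1 2 (zero_le_one.trans hL) hη.le) A0 M₀)
    (hq : qG 1 1 (B₀ * g.L ^ 3 + bB.κ * bB'.κ * νQ * νs * BI * (B₀ * g.L ^ 3) * (B₀ * g.L ^ 3) *
          Real.exp ((δG - 3 * ε) * r) * Real.exp ((δG - 3 * ε) * r) * c * c) θW c₈ < 1) :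
    HasMaj bB₂ (jetNegSize g blk blk₁ 1 2 (zero_le_one.trans hL) hη.le) A0 (fun y y' =>
      constA0 1 1 (B₀ * g.L ^ 3 + bB.κ * bB'.κ * νQ * νs * BI * (B₀ * g.L ^ 3) * (B₀ * g.L ^ 3) *
          Real.exp ((δG - 3 * ε) * r) * Real.exp ((δG - 3 * ε) * r) * c * c) θW cΔ A₀ c₈ *
        Real.exp (-(ρ / 8 * g.dist y y'))) := by
  have hL0 : 0 < g.L := lt_of_lt_of_le one_pos hL
  have hκB := bB.κ_nonneg
  have hκB' := bB'.κ_nonneg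
  have hBGt : 0 ≤ (B₀ * g.L ^ 3 + bB.κ * bB'.κ * νQ * νs * BI * (B₀ * g.L ^ 3) * (B₀ * g.L ^ 3) *
          Real.exp ((δG - 3 * ε) * r) * Real.exp ((δG - 3 * ε) * r) * c * c) := by
    positivity
  have hG := jet_tildeG_majorant_of_342 hL hη hd hgap hε hεL htri hrow hc hσ blk blk₁ D hGt hB₀ hBI hνQ hνs hρ
    hρG hρI h342_0 h342_1 hKQ hQloc hQrow hQ hKQs hQsloc hQscol hQs hInv
  exact A0_majorant_of_189 htri hd hρ hrow₈ hc₈ hBGt hθW hcΔ hA₀ hM₀ hG h189 hD2H0 hH0 h184 h188 hq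

end Concrete


end Literature.MathematicalPhysics.QuantumFieldTheory.Balaban1983to89.B11TildeG190
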